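import Literature.NumberTheory.Weil1964.AdelicThetaMajorants
import HarnessLib

/-!
# Theta majorants for tensor-product actions on `𝒮(𝔸_Fⁿ)`

KERNEL file (no cited facts used as hypotheses; no `def … : Prop` records).  The junction between a global
Weil-type representation given PLACE BY PLACE and the continuity input of the theta kernel
(`AdelicThetaMajorants.HasThetaMajorants`, Weil's Lemme 5 / Théorème 6 conj. 1 [Weil1964, Chap. III n° 41,
pp. 192–193]).

A family of linear operators `ρ(g)`, `g ∈ G`, on `𝒮(𝔸_Fⁿ) = piSchwartzBruhat F (Fin n)` is a **tensor action**
(`IsTensorAction ρ A B`) if on pure tensors `Φ_∞ ⊗ Φ_f` it acts by `ρ(g)(Φ_∞ ⊗ Φ_f) = A(g)Φ_∞ ⊗ B(g)Φ_f` with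

* an archimedean factor `A(g) : 𝓢((F ⊗ ℝ)ⁿ) → 𝓢((F ⊗ ℝ)ⁿ)` which is pointwise continuous in `g` and has
  LOCALLY UNIFORM Schwartz decay (`IsArchFactor`; implied by strong continuity `g ↦ A(g)Φ_∞` into the Schwartz
  space, `IsArchFactor.of_continuous`, and stable under continuous scalar corrections, `IsArchFactor.smul`);
* a finite factor `B(g)` preserving the Schwartz–Bruhat functions of `(𝔸_{F,f})ⁿ` and LOCALLY CONSTANT in `g`
  (`IsFinFactor` — a smooth representation of a totally disconnected group).

**Main theorem** `HasThetaMajorants.of_isTensorAction`: a tensor action has theta majorants; hence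
(`IsTensorAction.continuous_thetaDistLM`) `g ↦ Θ(ρ(g)Φ)` is continuous for every `Φ ∈ 𝒮(𝔸_Fⁿ)` — the input
`hc` of the theta-kernel constructors over `WeilThetaDatum.ofAction` / dual-pair representations.  Proof:
linearity reduces to pure tensors (`Submodule.span_induction`); near `g₀` the finite factor is constant, so all
`ρ(g)Φ` vanish off ONE compact set of finite parts and obey ONE bound `M (1 + ‖x_∞‖)^{-k}`
(`SchwartzMap.norm_le_mul_one_add_norm_rpow_neg`), and `HasThetaMajorants.of_decay` applies.

## References
* A. Weil, *Sur certains groupes d'opérateurs unitaires*, Acta Math. 111 (1964), Chap. III n° 41, Lemme 5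
  p. 192, Théorème 6 p. 193 [Weil1964].
-/

set_option autoImplicit false

noncomputable section

open scoped BigOperators Topology Classical
open NumberField NumberField.mixedEmbedding IsDedekindDomain Set Filter

namespace Literature.NumberTheory.Weil1964

open Literature.NumberTheory.Automorphic

variable {F : Type} [Field F] [NumberField F] {n : ℕ} {G : Type*} [TopologicalSpace G]

/-! ### §1. The archimedean factor -/

/-- **Archimedean factor data.** `A(g)Φ` is pointwise continuous in `g`, and near every `g₀` the functions
`A(g)Φ` obey one Schwartz decay bound of every order. [folklore] -/
structure IsArchFactor
    (A : G → SchwartzMap (Fin n → mixedSpace F) ℂ → SchwartzMap (Fin n → mixedSpace F) ℂ) : Prop where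
  /-- `g ↦ (A(g)Φ)(x)` is continuous -/
  continuous_eval : ∀ (Φ : SchwartzMap (Fin n → mixedSpace F) ℂ) (x : Fin n → mixedSpace F),
    Continuous fun g => A g Φ x
  /-- locally uniform decay of every order -/
  decay : ∀ (Φ : SchwartzMap (Fin n → mixedSpace F) ℂ) (k : ℕ) (g₀ : G), ∃ V ∈ 𝓝 g₀, ∃ S : ℝ, 0 ≤ S ∧
    ∀ g ∈ V, ∀ x, ‖A g Φ x‖ ≤ S * (1 + ‖x‖) ^ (-(k : ℝ))

/-- A finite sup of Schwartz seminorms is bounded by their sum. [folklore] -/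
theorem finset_sup_schwartzSeminorm_apply_le_sum {E : Type*} [NormedAddCommGroup E] [NormedSpace ℝ E]
    (s : Finset (ℕ × ℕ)) (f : SchwartzMap E ℂ) :
    s.sup (fun m => SchwartzMap.seminorm ℝ m.1 m.2) f ≤ ∑ m ∈ s, SchwartzMap.seminorm ℝ m.1 m.2 f := by
  induction s using Finset.induction_on with
  | empty => simp
  | insert a s ha ih =>
    rw [Finset.sup_insert, Finset.sum_insert ha, Seminorm.sup_apply]
    exact max_le (le_add_of_nonneg_right (Finset.sum_nonneg fun _ _ => apply_nonneg _ _))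
      (ih.trans (le_add_of_nonneg_left (apply_nonneg _ _)))

namespace IsArchFactor

variable {A : G → SchwartzMap (Fin n → mixedSpace F) ℂ → SchwartzMap (Fin n → mixedSpace F) ℂ}

/-- **Strong continuity suffices**: if `g ↦ A(g)Φ` is continuous into the Schwartz space (a continuous
representation on the Fréchet space `𝓢`), then `A` is an archimedean factor: evaluation and the Schwartz
seminorms are continuous on `𝓢`, so the decay constants are locally bounded. [folklore] -/
theorem of_continuous (hA : ∀ Φ, Continuous fun g => A g Φ) : IsArchFactor A := by
  refine ⟨fun Φ x => ?_, fun Φ k g₀ => ?_⟩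
  · have h := ((BoundedContinuousFunction.evalCLM ℝ x).comp
      (SchwartzMap.toBoundedContinuousFunctionCLM ℝ (Fin n → mixedSpace F) ℂ)).continuous.comp (hA Φ)
    exact h
  · -- the sum `T g` of the Schwartz seminorms of index `≤ (k, 0)` of `A g Φ` is continuous in `g`
    have hTc : Continuous fun g => ∑ m ∈ Finset.Iic (k, 0), SchwartzMap.seminorm ℝ m.1 m.2 (A g Φ) := by
      refine continuous_finsetSum _ fun m _ => ?_
      exact ((schwartz_withSeminorms ℝ (Fin n → mixedSpace F) ℂ).continuous_seminorm m).comp (hA Φ)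
    have hT0 : ∀ g, 0 ≤ ∑ m ∈ Finset.Iic (k, 0), SchwartzMap.seminorm ℝ m.1 m.2 (A g Φ) := fun g =>
      Finset.sum_nonneg fun m _ => apply_nonneg _ _
    have hsup : ∀ g, (Finset.Iic (k, 0)).sup (fun m => SchwartzMap.seminorm ℝ m.1 m.2) (A g Φ) ≤
        ∑ m ∈ Finset.Iic (k, 0), SchwartzMap.seminorm ℝ m.1 m.2 (A g Φ) := fun g =>
      finset_sup_schwartzSeminorm_apply_le_sum _ _
    have hmem : g₀ ∈ {g | ∑ m ∈ Finset.Iic (k, 0), SchwartzMap.seminorm ℝ m.1 m.2 (A g Φ) <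
        ∑ m ∈ Finset.Iic (k, 0), SchwartzMap.seminorm ℝ m.1 m.2 (A g₀ Φ) + 1} := by
      simp only [mem_setOf_eq, lt_add_iff_pos_right, zero_lt_one]
    refine ⟨_, (isOpen_lt hTc continuous_const).mem_nhds hmem,
      2 ^ k * (∑ m ∈ Finset.Iic (k, 0), SchwartzMap.seminorm ℝ m.1 m.2 (A g₀ Φ) + 1),
      mul_nonneg (pow_nonneg zero_le_two k) (add_nonneg (hT0 g₀) zero_le_one), fun g hg x => ?_⟩
    have h1 : (Finset.Iic (k, 0)).sup (fun m => SchwartzMap.seminorm ℝ m.1 m.2) (A g Φ) ≤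
        ∑ m ∈ Finset.Iic (k, 0), SchwartzMap.seminorm ℝ m.1 m.2 (A g₀ Φ) + 1 :=
      (hsup g).trans (le_of_lt hg)
    have h2 : 0 ≤ (1 + ‖x‖) ^ (-(k : ℝ)) := Real.rpow_nonneg (by positivity) _
    calc ‖A g Φ x‖ ≤ 2 ^ k * (Finset.Iic (k, 0)).sup (fun m => SchwartzMap.seminorm ℝ m.1 m.2) (A g Φ) *
          (1 + ‖x‖) ^ (-(k : ℝ)) := SchwartzMap.norm_le_mul_one_add_norm_rpow_neg (A g Φ) k x
      _ ≤ 2 ^ k * (∑ m ∈ Finset.Iic (k, 0), SchwartzMap.seminorm ℝ m.1 m.2 (A g₀ Φ) + 1) *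
          (1 + ‖x‖) ^ (-(k : ℝ)) :=
        mul_le_mul_of_nonneg_right (mul_le_mul_of_nonneg_left h1 (pow_nonneg zero_le_two k)) h2

/-- Archimedean factors are stable under continuous scalar corrections `χ(g) • A(g)` (e.g. the cocycle
correction of a projective representation). [folklore] -/
theorem smul (hA : IsArchFactor A) {χ : G → ℂ} (hχ : Continuous χ) :
    IsArchFactor fun g Φ => χ g • A g Φ := by
  refine ⟨fun Φ x => ?_, fun Φ k g₀ => ?_⟩
  · show Continuous fun g => χ g • A g Φ x
    exact hχ.smul (hA.continuous_eval Φ x)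
  · obtain ⟨V, hV, S, hS0, hS⟩ := hA.decay Φ k g₀
    have hχb : {g | ‖χ g‖ < ‖χ g₀‖ + 1} ∈ 𝓝 g₀ :=
      (isOpen_lt (continuous_norm.comp hχ) continuous_const).mem_nhds (by simp)
    refine ⟨V ∩ {g | ‖χ g‖ < ‖χ g₀‖ + 1}, inter_mem hV hχb, (‖χ g₀‖ + 1) * S, by positivity,
      fun g hg x => ?_⟩
    rw [show (χ g • A g Φ) x = χ g • A g Φ x from rfl, _root_.norm_smul, mul_assoc]
    exact mul_le_mul (le_of_lt hg.2) (hS g hg.1 x) (norm_nonneg _) (by positivity)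

/-- A **constant** archimedean factor `A(g) = T` (e.g. the Fourier transform). [folklore] -/
theorem of_const (T : SchwartzMap (Fin n → mixedSpace F) ℂ → SchwartzMap (Fin n → mixedSpace F) ℂ) :
    IsArchFactor fun (_ : G) => T :=
  of_continuous fun _ => continuous_const

end IsArchFactor

/-! ### §2. The finite factor -/

/-- **Finite factor data.** `B(g)` preserves the Schwartz–Bruhat functions of `(𝔸_{F,f})ⁿ` and `g ↦ B(g)Φ_f`
is locally constant (a smooth action of a totally disconnected group). [folklore] -/
structure IsFinFactor (B : G → ((Fin n → FiniteAdeleRing (𝓞 F) F) → ℂ) →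
    ((Fin n → FiniteAdeleRing (𝓞 F) F) → ℂ)) : Prop where
  /-- Schwartz–Bruhat functions go to Schwartz–Bruhat functions -/
  mem : ∀ (g : G) (Φf : (Fin n → FiniteAdeleRing (𝓞 F) F) → ℂ),
    Φf ∈ SchwartzBruhat (Fin n → FiniteAdeleRing (𝓞 F) F) →
      B g Φf ∈ SchwartzBruhat (Fin n → FiniteAdeleRing (𝓞 F) F)
  /-- `g ↦ B(g)Φ_f` is locally constant -/
  locallyConstant : ∀ (Φf : (Fin n → FiniteAdeleRing (𝓞 F) F) → ℂ),
    Φf ∈ SchwartzBruhat (Fin n → FiniteAdeleRing (𝓞 F) F) → IsLocallyConstant fun g => B g Φf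

namespace IsFinFactor

/-- The **trivial finite factor** `B(g) = id` (use it to view an action on the archimedean factor alone
as a tensor action). [folklore] -/
theorem trivial : IsFinFactor (F := F) (n := n) fun (_ : G) Φf => Φf :=
  ⟨fun _ _ h => h, fun Φf _ => IsLocallyConstant.const Φf⟩

/-- A finite factor from a **smooth action**: if `B` is multiplicative on Schwartz–Bruhat functions and
every Schwartz–Bruhat `Φ_f` is fixed by a neighbourhood of `1` (e.g. by a compact open subgroup), then
`g ↦ B(g)Φ_f` is locally constant. [folklore] -/
theorem of_smooth [Group G] [ContinuousMul G]
    {B : G → ((Fin n → FiniteAdeleRing (𝓞 F) F) → ℂ) → ((Fin n → FiniteAdeleRing (𝓞 F) F) → ℂ)}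
    (hmem : ∀ (g : G) (Φf : (Fin n → FiniteAdeleRing (𝓞 F) F) → ℂ),
      Φf ∈ SchwartzBruhat (Fin n → FiniteAdeleRing (𝓞 F) F) →
        B g Φf ∈ SchwartzBruhat (Fin n → FiniteAdeleRing (𝓞 F) F))
    (hmul : ∀ (g k : G) (Φf : (Fin n → FiniteAdeleRing (𝓞 F) F) → ℂ),
      Φf ∈ SchwartzBruhat (Fin n → FiniteAdeleRing (𝓞 F) F) → B (g * k) Φf = B g (B k Φf))
    (hfix : ∀ (Φf : (Fin n → FiniteAdeleRing (𝓞 F) F) → ℂ),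
      Φf ∈ SchwartzBruhat (Fin n → FiniteAdeleRing (𝓞 F) F) →
        ∃ K ∈ 𝓝 (1 : G), ∀ k ∈ K, B k Φf = Φf) :
    IsFinFactor B := by
  refine ⟨hmem, fun Φf hΦf => (IsLocallyConstant.iff_eventually_eq _).2 fun g₀ => ?_⟩
  obtain ⟨K, hK, hfixK⟩ := hfix Φf hΦf
  have h1 : Filter.Tendsto (fun g => g₀⁻¹ * g) (𝓝 g₀) (𝓝 1) := by
    have h := ((continuous_const_mul g₀⁻¹).tendsto g₀ :
      Filter.Tendsto (fun g => g₀⁻¹ * g) (𝓝 g₀) (𝓝 (g₀⁻¹ * g₀)))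
    rwa [inv_mul_cancel] at h
  filter_upwards [h1 hK] with g hg
  calc B g Φf = B (g₀ * (g₀⁻¹ * g)) Φf := by rw [mul_inv_cancel_left]
    _ = B g₀ (B (g₀⁻¹ * g) Φf) := hmul _ _ _ hΦf
    _ = B g₀ Φf := by rw [hfixK _ hg]

end IsFinFactor

/-! ### §3. Tensor actions and their theta majorants -/

/-- **Tensor action** of `G` on `𝒮(𝔸_Fⁿ)`: linear operators `ρ(g)` acting on pure tensors by
`ρ(g)(Φ_∞ ⊗ Φ_f) = A(g)Φ_∞ ⊗ B(g)Φ_f` with an archimedean factor `A` and a finite factor `B`. [folklore] -/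
structure IsTensorAction (ρ : G → Module.End ℂ (piSchwartzBruhat F (Fin n)))
    (A : G → SchwartzMap (Fin n → mixedSpace F) ℂ → SchwartzMap (Fin n → mixedSpace F) ℂ)
    (B : G → ((Fin n → FiniteAdeleRing (𝓞 F) F) → ℂ) → ((Fin n → FiniteAdeleRing (𝓞 F) F) → ℂ)) :
    Prop where
  /-- the archimedean factor -/
  arch : IsArchFactor A
  /-- the finite factor -/
  fin : IsFinFactor B
  /-- the action on pure tensors -/
  tensor : ∀ (g : G) (Φinf : SchwartzMap (Fin n → mixedSpace F) ℂ)
    (Φfin : (Fin n → FiniteAdeleRing (𝓞 F) F) → ℂ)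
    (hfin : Φfin ∈ SchwartzBruhat (Fin n → FiniteAdeleRing (𝓞 F) F)),
    ((ρ g ⟨_, tensor_mem_piSchwartzBruhat Φinf hfin⟩ : piSchwartzBruhat F (Fin n)) :
        (Fin n → AdeleRing (𝓞 F) F) → ℂ) =
      fun x => A g Φinf (piArch F (Fin n) x) * B g Φfin (piFinite F (Fin n) x)

namespace IsTensorAction

variable {ρ : G → Module.End ℂ (piSchwartzBruhat F (Fin n))}
  {A : G → SchwartzMap (Fin n → mixedSpace F) ℂ → SchwartzMap (Fin n → mixedSpace F) ℂ}
  {B : G → ((Fin n → FiniteAdeleRing (𝓞 F) F) → ℂ) → ((Fin n → FiniteAdeleRing (𝓞 F) F) → ℂ)}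

/-- **Pointwise continuity** of `g ↦ (ρ(g)Φ)(x)` for every `Φ ∈ 𝒮(𝔸_Fⁿ)` (pure tensors: continuous times
locally constant; then linearity). [folklore] -/
theorem continuous_apply (h : IsTensorAction ρ A B) (Φ : piSchwartzBruhat F (Fin n))
    (x : Fin n → AdeleRing (𝓞 F) F) :
    Continuous fun g => ((ρ g Φ : piSchwartzBruhat F (Fin n)) : (Fin n → AdeleRing (𝓞 F) F) → ℂ) x := by
  obtain ⟨Φ, hΦ⟩ := Φ
  induction hΦ using Submodule.span_induction with
  | mem Ψ hΨ =>
    obtain ⟨Ψinf, Ψfin, hfin, rfl⟩ := hΨ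
    have heq : ∀ g, ((ρ g ⟨_, Submodule.subset_span ⟨Ψinf, Ψfin, hfin, rfl⟩⟩ : piSchwartzBruhat F (Fin n)) :
        (Fin n → AdeleRing (𝓞 F) F) → ℂ) x =
        A g Ψinf (piArch F (Fin n) x) * B g Ψfin (piFinite F (Fin n) x) := fun g => by
      rw [show (⟨_, Submodule.subset_span ⟨Ψinf, Ψfin, hfin, rfl⟩⟩ : piSchwartzBruhat F (Fin n)) =
        ⟨_, tensor_mem_piSchwartzBruhat Ψinf hfin⟩ from rfl, h.tensor g Ψinf Ψfin hfin]
    simp_rw [heq]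
    exact (h.arch.continuous_eval Ψinf _).mul
      (((h.fin.locallyConstant Ψfin hfin).comp (fun f => f (piFinite F (Fin n) x))).continuous)
  | zero =>
    simp_rw [show (⟨0, Submodule.zero_mem _⟩ : piSchwartzBruhat F (Fin n)) = 0 from rfl, map_zero]
    exact continuous_const
  | add Φ Ψ hΦ hΨ ihΦ ihΨ =>
    simp_rw [show (⟨Φ + Ψ, Submodule.add_mem _ hΦ hΨ⟩ : piSchwartzBruhat F (Fin n)) =
      ⟨Φ, hΦ⟩ + ⟨Ψ, hΨ⟩ from rfl, map_add, Submodule.coe_add, Pi.add_apply]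
    exact ihΦ.add ihΨ
  | smul c Φ hΦ ih =>
    simp_rw [show (⟨c • Φ, Submodule.smul_mem _ c hΦ⟩ : piSchwartzBruhat F (Fin n)) = c • ⟨Φ, hΦ⟩ from rfl,
      map_smul, Submodule.coe_smul, Pi.smul_apply]
    exact ih.const_smul c

/-- **Locally uniform decay data** for `ρ(g)Φ`: near every `g₀`, one bound `M (1 + ‖x_∞‖)^{-k}` and one compact
set of finite parts for all `g`. [folklore] -/
theorem exists_decay (h : IsTensorAction ρ A B) (Φ : piSchwartzBruhat F (Fin n)) (k : ℕ) (g₀ : G) :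
    ∃ V ∈ 𝓝 g₀, ∃ (M : ℝ) (Cf : Set (Fin n → FiniteAdeleRing (𝓞 F) F)), 0 ≤ M ∧ IsCompact Cf ∧
      ∀ g ∈ V,
        (∀ x, ‖((ρ g Φ : piSchwartzBruhat F (Fin n)) : (Fin n → AdeleRing (𝓞 F) F) → ℂ) x‖ ≤
            M * (1 + ‖vecInfinitePart F n x‖) ^ (-(k : ℝ))) ∧
        (∀ x, vecFinitePart F n x ∉ Cf →
            ((ρ g Φ : piSchwartzBruhat F (Fin n)) : (Fin n → AdeleRing (𝓞 F) F) → ℂ) x = 0) := by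
  obtain ⟨Φ, hΦ⟩ := Φ
  induction hΦ using Submodule.span_induction with
  | mem Ψ hΨ =>
    obtain ⟨Ψinf, Ψfin, hfin, rfl⟩ := hΨ
    have heq : ∀ g, ((ρ g ⟨_, Submodule.subset_span ⟨Ψinf, Ψfin, hfin, rfl⟩⟩ : piSchwartzBruhat F (Fin n)) :
        (Fin n → AdeleRing (𝓞 F) F) → ℂ) =
        fun x => A g Ψinf (piArch F (Fin n) x) * B g Ψfin (piFinite F (Fin n) x) := fun g => by
      rw [show (⟨_, Submodule.subset_span ⟨Ψinf, Ψfin, hfin, rfl⟩⟩ : piSchwartzBruhat F (Fin n)) =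
        ⟨_, tensor_mem_piSchwartzBruhat Ψinf hfin⟩ from rfl, h.tensor g Ψinf Ψfin hfin]
    -- archimedean: one decay constant near `g₀`
    obtain ⟨V, hV, S, hS0, hS⟩ := h.arch.decay Ψinf k g₀
    -- finite: `B g Ψfin = B g₀ Ψfin` near `g₀`
    have hU : {g | B g Ψfin = B g₀ Ψfin} ∈ 𝓝 g₀ :=
      ((h.fin.locallyConstant Ψfin hfin).isOpen_fiber (B g₀ Ψfin)).mem_nhds rfl
    obtain ⟨hlc₀, hcs₀⟩ := (mem_schwartzBruhat_iff).1 (h.fin.mem g₀ Ψfin hfin)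
    obtain ⟨Mf, hMf⟩ := hlc₀.continuous.bounded_above_of_compact_support hcs₀
    have hMf0 : 0 ≤ Mf := (norm_nonneg _).trans (hMf 0)
    refine ⟨V ∩ {g | B g Ψfin = B g₀ Ψfin}, inter_mem hV hU, S * Mf, tsupport (B g₀ Ψfin),
      mul_nonneg hS0 hMf0, hcs₀, fun g hg => ⟨fun x => ?_, fun x hx => ?_⟩⟩
    · rw [heq g, norm_mul, hg.2]
      calc ‖A g Ψinf (piArch F (Fin n) x)‖ * ‖B g₀ Ψfin (piFinite F (Fin n) x)‖
          ≤ S * (1 + ‖vecInfinitePart F n x‖) ^ (-(k : ℝ)) * Mf :=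
            mul_le_mul (hS g hg.1 _) (hMf _) (norm_nonneg _)
              (mul_nonneg hS0 (Real.rpow_nonneg (by positivity) _))
        _ = S * Mf * (1 + ‖vecInfinitePart F n x‖) ^ (-(k : ℝ)) := by ring
    · rw [heq g]
      beta_reduce
      rw [hg.2, show piFinite F (Fin n) x = vecFinitePart F n x from rfl, image_eq_zero_of_notMem_tsupport hx,
        mul_zero]
  | zero =>
    refine ⟨univ, univ_mem, 0, ∅, le_rfl, isCompact_empty, fun g _ => ⟨fun x => ?_, fun x _ => ?_⟩⟩
    · rw [show (⟨0, Submodule.zero_mem _⟩ : piSchwartzBruhat F (Fin n)) = 0 from rfl, map_zero]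
      simp
    · rw [show (⟨0, Submodule.zero_mem _⟩ : piSchwartzBruhat F (Fin n)) = 0 from rfl, map_zero]
      rfl
  | add Φ Ψ hΦ hΨ ihΦ ihΨ =>
    obtain ⟨V₁, hV₁, M₁, C₁, hM₁, hC₁, h₁⟩ := ihΦ
    obtain ⟨V₂, hV₂, M₂, C₂, hM₂, hC₂, h₂⟩ := ihΨ
    refine ⟨V₁ ∩ V₂, inter_mem hV₁ hV₂, M₁ + M₂, C₁ ∪ C₂, add_nonneg hM₁ hM₂, hC₁.union hC₂,
      fun g hg => ⟨fun x => ?_, fun x hx => ?_⟩⟩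
    · rw [show (⟨Φ + Ψ, Submodule.add_mem _ hΦ hΨ⟩ : piSchwartzBruhat F (Fin n)) = ⟨Φ, hΦ⟩ + ⟨Ψ, hΨ⟩
        from rfl, map_add, Submodule.coe_add, Pi.add_apply]
      calc _ ≤ _ := norm_add_le _ _
        _ ≤ M₁ * (1 + ‖vecInfinitePart F n x‖) ^ (-(k : ℝ)) + M₂ * (1 + ‖vecInfinitePart F n x‖) ^ (-(k : ℝ)) :=
            add_le_add ((h₁ g hg.1).1 x) ((h₂ g hg.2).1 x)
        _ = (M₁ + M₂) * (1 + ‖vecInfinitePart F n x‖) ^ (-(k : ℝ)) := by ring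
    · rw [mem_union, not_or] at hx
      rw [show (⟨Φ + Ψ, Submodule.add_mem _ hΦ hΨ⟩ : piSchwartzBruhat F (Fin n)) = ⟨Φ, hΦ⟩ + ⟨Ψ, hΨ⟩
        from rfl, map_add, Submodule.coe_add, Pi.add_apply, (h₁ g hg.1).2 x hx.1, (h₂ g hg.2).2 x hx.2,
        add_zero]
  | smul c Φ hΦ ih =>
    obtain ⟨V, hV, M, C, hM, hC, h₁⟩ := ih
    refine ⟨V, hV, ‖c‖ * M, C, mul_nonneg (norm_nonneg _) hM, hC, fun g hg => ⟨fun x => ?_, fun x hx => ?_⟩⟩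
    · rw [show (⟨c • Φ, Submodule.smul_mem _ c hΦ⟩ : piSchwartzBruhat F (Fin n)) = c • ⟨Φ, hΦ⟩ from rfl,
        map_smul, Submodule.coe_smul, Pi.smul_apply, _root_.norm_smul, mul_assoc]
      exact mul_le_mul_of_nonneg_left ((h₁ g hg).1 x) (norm_nonneg _)
    · rw [show (⟨c • Φ, Submodule.smul_mem _ c hΦ⟩ : piSchwartzBruhat F (Fin n)) = c • ⟨Φ, hΦ⟩ from rfl,
        map_smul, Submodule.coe_smul, Pi.smul_apply, (h₁ g hg).2 x hx, smul_zero]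

/-- **A tensor action has theta majorants** (Weil's Lemme 5 for a representation given by local data).
[cite: Weil1964, Chap. III n° 41, Lemme 5 p. 192] -/
theorem hasThetaMajorants (h : IsTensorAction ρ A B) : HasThetaMajorants (F := F) fun g Φ => ρ g Φ := by
  refine HasThetaMajorants.of_decay (fun Φ ξ => h.continuous_apply Φ _) fun Φ g₀ => ?_
  set k : ℕ := ⌊(n : ℝ) * Module.finrank ℚ F⌋₊ + 1 with hk
  have hk' : (n : ℝ) * Module.finrank ℚ F < k := by
    rw [hk, Nat.cast_add, Nat.cast_one]
    exact Nat.lt_floor_add_one _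
  obtain ⟨V, hV, M, Cf, hM, hCf, hdec⟩ := h.exists_decay Φ k g₀
  exact ⟨V, hV, M, k, Cf, hM, hCf, hk', hdec⟩

/-- **Continuity of the theta kernel in the group variable** for a tensor action: `g ↦ Θ(ρ(g)Φ)` is
continuous for every `Φ ∈ 𝒮(𝔸_Fⁿ)` (Théorème 6, conjunct 1). [cite: Weil1964, Chap. III n° 41, Thm 6 p. 193] -/
theorem continuous_thetaDistLM (h : IsTensorAction ρ A B) (Φ : piSchwartzBruhat F (Fin n)) :
    Continuous fun g => thetaDistLM F (Fin n) (ρ g Φ) :=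
  h.hasThetaMajorants.continuous_thetaDistLM Φ

end IsTensorAction

end Literature.NumberTheory.Weil1964

end
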